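import Mathlib
import HarnessLib
import HarnessLib.Audit
import Summits.AtomisticToContinuum.Statement
import Literature.Barriers.AtomisticToContinuum.FixedLengthNoConductivityControl
import Literature.MathematicalPhysics.KineticTheory.LangevinChainKernel
import Literature.MathematicalPhysics.KineticTheory.LangevinChainNESSHolds
import Summits.AtomisticToContinuum.FouriersLaw.Theorems.OddSectorIrreversibilityGibbsSteadyState
import Summits.AtomisticToContinuum.FouriersLaw.Theorems.EmbeddedDrudeMourreNessUnique
import Summits.AtomisticToContinuum.FouriersLaw.Theorems.FourierGreenKuboFourierFiniteResponseOfUnique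

/-!
Route: StaticIrreversibility

CLOSED (retired) 2026-08-15T13:46:46Z by operator:999:1257524 — reason: not-a-thesis: assembly does not conclude the sub-problem Statement — note: D-0027 §2.1 audit (human 2026-08-15: routes that do not decide the summit are removed): the assembly concludes `Literature.MathematicalPhysics.KineticTheory.HeatConduction.FouriersLaw`, not the sub-problem statement; a NEW conforming route may be opened from the same idea (generated `closes : … → _r. The file is kept as the record of this route; refuted decls are indexed as negative knowledge (`ledger negatives`).

# Route StaticIrreversibility — the NESS hides its arrow of time — N·‖odd part of the response
density‖² ≤ C ⇒ bounded response in one line; odd-sector corrector decay as engine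

X = SI ∧ (import slot), realising idea card static-irreversibility-loschmidt-echo (spine; its items
2, 4, 5 and the
litmus 6–7). Notation: pinnedChain ω₂ lam β γ (all four > 0), T > 0, weak-NESS uniqueness
(NessUnique, stmt-0741) assumed where
stated, μ_{N,T_L,T_R} the steady-state family, Θ(q,p) = (q,−p) the momentum reversal, μ_T :=
μ_{N,T,T} (= the Gibbs state
Z⁻¹e^{−H_N/T}, GibbsSteadyState + uniqueness), h_N ∈ L²(μ_T) THE linear-response density of δ ↦
μ_{N,T+δ/2,T−δ/2} at δ = 0
(weak derivative against C_c^∞ observables and the bond currents; ResponseDensity), J_tot = Σ_bonds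
j_i.
SI (OddResponseBound): ∃ C(T) ∀ N ≥ 2: N · ∫ (h_N − h_N∘Θ)² dμ_T ≤ C — the Θ-ODD part of the
response density is O(N^{-1/2})
in L²(Gibbs); in information-theoretic words the STATIC IRREVERSIBILITY of the steady state, b_N(δ)
:= KL(μ_{N,δ} ‖ Θ_*μ_{N,δ})
= ½δ² ∫(h_N − h_N∘Θ)² + o(δ²) (ReversalKLSecondOrder), is O(δ²/N): a long Fourier conductor is
time-reversal symmetric up to
O(δ²/N) nats, whereas the ballistic harmonic member has b_N ≍ Nδ² (extensive arrow of time).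
ONE-LINE SUFFICIENCY (OddSufficiency, support): D_N = Σ_i dμ_δ(j_i)/dδ = ⟨J_tot, h_N⟩_{μ_T} =
½⟨J_tot, h_N − h_N∘Θ⟩ (J_tot is
Θ-odd, μ_T Θ-invariant) ≤ ½‖J_tot‖_{L²(μ_T)} · ‖h_N − h_N∘Θ‖ ≤ ½√(cN)·√(C/N), using ‖J_tot‖² ≤ cN
(CurrentVarianceLinear:
neighbouring bond currents only correlate under Gibbs) — i.e. HasBoundedResponse, the catalogued
necessary waypoint. The import
slot BoundedResponseConverges (stmt-2741, 'Fourier minus boundedness', owned by the Fekete /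
Green–Kubo lines) then yields
κ(T) = lim D_N ∈ (0, ∞) and, with clause (i) from the PROVED pinnedChain_exists_isSteadyState +
NessUnique, FouriersLaw.
ENGINE for SI (OddCorrectorDecay, rank 2): by the McLennan / open-chain Green–Kubo calculus
(OddDensityIsCorrector, support)
h_N − h_N∘Θ = (u_N − u_N∘Θ)/((N−1)T²) with u_N = ∫₀^∞ P_t J_tot dt the Kubo corrector of the
EQUILIBRIUM open chain, so SI ⟺
‖P_odd u_N‖² = O(N), which follows from N-uniform INTEGRATED L²(Gibbs)-decay of the odd part of P_t
J_tot:
∫₀^∞ ‖P_tJ_tot − (P_tJ_tot)∘Θ‖ dt ≤ C ‖J_tot‖ (EngineGlue: Minkowski + Fatou).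
Lean: `OddResponseBound ∧ BoundedResponseConverges`

## Assembly
OddSufficiency (support) turns GibbsSteadyState + CurrentVarianceLinear + ResponseDensity +
OddResponseBound into BoundedResponse by one
Cauchy–Schwarz inequality; the tail is the standard one of LocalOhmRigidity / FeketeResistance:
clause (i) from the PROVED
Literature.MathematicalPhysics.KineticTheory.HeatConduction.pinnedChain_exists_isSteadyState (all N)
+ NessUnique; canonical family by
Classical.choose; D_N(T) from FiniteResponseOfUnique; BddAbove from BoundedResponse
(HasBoundedResponse applied to the family and D);
BoundedResponseConverges ⇒ D_N → k(T) > 0; κ T := k(T) for T > 0 (else 1); any other steady-state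
family has the same difference
quotients for |δ| < 2T by uniqueness (Filter.Tendsto.congr', as in
hasBoundedResponse_iff_of_unique). Provers may enter at rank 2 instead:
EngineGlue derives OddResponseBound from OddCorrectorDecay + OddDensityIsCorrector +
CurrentVarianceLinear. Imports for provers:
Literature.Barriers.AtomisticToContinuum.FixedLengthNoConductivityControl,
Literature.MathematicalPhysics.KineticTheory.LangevinChainKernel
(transitionKernel), Literature.MathematicalPhysics.KineticTheory.LangevinChainNESSHolds (or the
route file). All 14 decls elaborate
(planner Sketch.lean, lean check rc 0).

Rationale: WHY THIS LINE. Every FouriersLaw route must pass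
Literature.Barriers.AtomisticToContinuum.HasBoundedResponse (necessity PROVED,
hasBoundedResponse_of_fouriersLawFor) and the catalogued reason no fixed-N tool controls N is that
the open chain's slow modes close
every rate (BeckerMenegaki2022_gapClosing; equilibrium_rate_bound: the centred ENERGY — a Θ-EVEN
vector — leaves only through two
boundary momenta). This line imports the parity calculus of stochastic thermodynamics with odd
variables (SpinneyFord2012's
stationary asymmetry; the symmetrised entropy of KomatsuNakagawaSasaTasaki2011, arXiv:1009.0970 p.6
and p.13: S_sym = Shannon +
½·KL(ρ‖ρ∘Θ), 'we still do not have any further interpretation') and the McLennan / open-system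
Green–Kubo representation of the
first-order NESS correction (MaesNetocny2010; KunduDharNarayan2009 eqs. (reln2)–(reln3): detailed
balance W P₀ = ΘWΘ P₀ and
∫⟨J(t)J(0)⟩ = (N−1)∫⟨J(0)J_b(t)⟩), and splits the linear-response density by momentum-reversal
parity: the current couples ONLY to
the odd part, while all hydrodynamic content (temperature profile ≍ Σ(½ − x/(N−1))ẽ_x, long-range
energy correlations) is even and
invisible to b_N; bounded response becomes the L²-smallness of ONE odd vector ('local equilibrium in
the odd sector') and the dynamical
obligation becomes integrated decay of P_odd P_t J_tot in the symmetry sector that carries no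
conserved or hydrodynamic mode (pinning
kills momentum, energy is even; on every finite open chain J_tot = {H, Σ k e_k} is a Poisson
bracket, sum_bondCurrent_eq_poisson PROVED).
Gaspard2022 §5.4 eq. (5.98) identifies the DYNAMIC arrow (KL rate of current fluctuations vs their
reversal) with entropy production
≍ κδ²/(NT²) — trivially O(δ²/N) under Fourier; the STATIC snapshot KL b_N is the new transport order
parameter (N / N⁻¹ / e^{−N}:
ballistic / Fourier / insulating) and its O(δ²/N) is what this route must prove. No physical analogy
beyond the exact dictionary
b_N ↔ 2δ²‖P_odd h_N‖² ↔ −(N−1)T²·½∂_s D_N(s)|₀ under rare global reversals (Loschmidt-echo reading,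
not load-bearing). What prior
routes do not do: FourierGreenKubo needs infinite-volume L¹ decay of the FULL current
autocorrelation plus κ = κ_GK; LocalOhmRigidity
a local Ohm inequality and BV profiles; FeketeResistance / SuperadditiveJunction / EscapeDeficit
leave HasBoundedResponse as a
residual or reduce it to other finite-N certificates — none resolves it by parity at finite N with
the difficulty isolated in one norm.
Benchmark outcome already in hand (planner, exact Gaussian linear algebra, this session — see §
Cheapest falsifier): for the Bonetto–Lebowitz–Lukkarinen 2004
self-consistent harmonic chain (Fourier proved) N·∫(h−h∘Θ)²dμ_T = 0.865, 0.833, 0.818, 0.809, 0.803,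
0.799, 0.792, 0.787 for
N = 3, 4, 5, 6, 7, 8, 10, 12 (monotonically ↘ towards ≈ 0.78: SI holds EXACTLY at the Fourier
scaling), while the Rieder–Lebowitz–Lieb chain
pinnedChain(1,0,0,1) gives ∫(h−h∘Θ)² = 0.68, 0.94, 1.56, 2.22, 2.89, 3.56 for N = 3, 4, 6, 8, 10, 12
≈ 0.33·N (extensive, as it must): the card's kill test (item 7) passes and its calibration (item 6)
is confirmed.

RANKED CRUXES. #2 OddCorrectorDecay (crux) — (OSD, card item 4 — the engine) for all ω₂, lam, β, γ >
0 and T > 0 there is C(T) such that for EVERY N, with P_t the transition semigroup of the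
EQUILIBRIUM open chain (both baths at T; OscillatorChain.transitionKernel, constructed in tree — no
∃/∀-semigroup ambiguity) and μ_T the Gibbs weight e^{−H_N/T} dq dp (unnormalised: both sides scale
alike): t ↦ ‖P_tJ_tot − (P_tJ_tot)∘Θ‖_{L²(μ_T)} is integrable on (0,∞) and ∫₀^∞ ‖P_tJ_tot −
(P_tJ_tot)∘Θ‖ dt ≤ C·‖J_tot‖_{L²(μ_T)}, J_tot = Σ_i j_i. INTEGRATED decay of ONE odd vector, uniform
in N — not a rate, not the full autocorrelation. Heuristic budget: transient ≍ τ‖J‖ plus the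
boundary diffusive tail ‖P_odd P_tJ‖ ≍ t^{-3/4} on (1, N²) contributing ≍ √N ≍ ‖J‖ — marginal but
consistent; harmonic chain: the ratio ∫‖P_odd P_tJ‖dt/‖J‖ grows at least linearly in N (ballistic
phonons between the contacts; band-edge odd momenta live ≍ N³), fails as it must. [difficulty:
open-problem] (why it might fail: (i) an odd quasi-conserved charge (Mazur class) makes it ≍N; (ii)
C(T)≍(lamT)⁻² near the harmonic corner — fine pointwise in T only; (iii) norm-integrability exceeds
Green–Kubo: a non-decaying oscillating odd component, or a boundary tail heavier than t^{-3/4},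
breaks OSD with SI intact.) [BeckerMenegaki2022, KunduDharNarayan2009, BonettoLebowitzReyBellet2000,
AokiLukkarinenSpohn2006, LepriLiviPoliti2003,
Literature.Barriers.AtomisticToContinuum.equilibrium_rate_bound, CuneoEckmannHairerReyBellet2018]
#3 OddResponseBound (crux) — (SI, card items 2/5 — the X of the thesis) under weak-NESS uniqueness,
for every steady-state family μ and T > 0 there is C with: for all N ≥ 2 and every h that is the
L²(μ_{N,T,T}) linear-response density of δ ↦ μ_{N,T+δ/2,T−δ/2} at δ = 0 (weak derivative on C_c^∞
observables AND on the bond currents — the predicate pins h down uniquely; existence is the separate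
support item ResponseDensity, so nothing is smuggled), h − h∘Θ ∈ L²(μ_{N,T,T}) and N·∫(h − h∘Θ)²
dμ_{N,T,T} ≤ C. Equivalent readings: b_N = KL(NESS‖Θ NESS) = O(δ²/N) (ReversalKLSecondOrder); ‖P_odd
u_N‖² = O(N) for the Kubo corrector (OddDensityIsCorrector). Benchmarks (planner, exact): BLL2004
self-consistent chain N·∫(h−hΘ)² = 0.87 ↘ 0.79 for N = 3…12 (decreasing); RLL harmonic chain
∫(h−hΘ)² ≈ 0.33·N. [deps: OddCorrectorDecay] [difficulty: open-problem] (why it might fail: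
Sufficient, maybe not necessary: first-order long-range ODD correlations (δ/N over ≍N² pairs) would
give ∫(h−hΘ)² ≍ 1 with Fourier intact (absent in BLL2004, where it is ≍1/N exactly); ≍N for the
harmonic member; nothing N-uniform is known for any deterministic anharmonic chain.)
[KomatsuNakagawaSasaTasaki2011, SpinneyFord2012, MaesNetocny2010, BonettoLebowitzLukkarinen2004,
BernardinOlla2005, RiederLebowitzLieb1967,
Literature.Barriers.AtomisticToContinuum.HasBoundedResponse]
#4 BoundedResponseConverges (crux) — IMPORT SLOT (verbatim stmt-AtomisticToContinuum-2741 of route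
LocalOhmRigidity; dedup attaches this route): under uniqueness, along any steady-state family and T
> 0, if the response coefficients D_N of clause (ii) exist and (|D_N|) is bounded then D_N → k for
some k > 0. 'FouriersLawFor minus HasBoundedResponse'; expected from FeketeResistance
(QuasiSubadditiveResistance + PositiveConductance + FeketeGlue) or FourierGreenKubo's
ThermodynamicLimit — NOT this route's mechanism, declared residual once HasBoundedResponse is in
hand. [difficulty: L] (why it might fail: D_N may oscillate in N (no monotonicity or subadditivity
in the length is known; size resonances at low T where the mean free path exceeds N) or tend to 0
(no N-uniform lower bound on the conductance beyond μ(Φ) > 0 at fixed N).)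
[BonettoLebowitzReyBellet2000, EckmannPilletReyBellet1999b, LepriLiviPoliti2003]
#9 NessUnique (support) — (= stmt-AtomisticToContinuum-0741, shared) uniqueness of the weak steady
state (IsSteadyState class) for pinnedChain, all N, T_L, T_R > 0; print: CEHR2018 Thm 2.13(1) for
the invariant measure (thm213_holds PROVED in tree) + the Fokker–Planck identification lemma
(Echeverría / well-posed martingale problem). [difficulty: M] [CuneoEckmannHairerReyBellet2018,
Carmona2007]
#9 FiniteResponseOfUnique (support) — (= stmt-AtomisticToContinuum-0717, shared) under uniqueness
the finite-N response limits D_N(T) exist (differentiability at equilibrium of NESS expectations of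
the polynomial currents; Hairer–Majda framework / Rey-Bellet 2003 Rem 4.4). Implied by
ResponseDensity (sum over bonds) but kept verbatim for dedup and for the assembly tail. [difficulty:
M] [ReyBellet2003, HairerMajda2009]
#9 GibbsSteadyState (support) — (= stmt-AtomisticToContinuum-0718 FourierGibbsSteadyState, shared)
the normalised Gibbs measure Z⁻¹e^{−H_N/T} is a weak steady state at T_L = T_R = T with zero total
current; with NessUnique it IS μ_{N,T,T}, giving Θ-invariance of μ_T and the explicit density used
by CurrentVarianceLinear / OddCorrectorDecay. [difficulty: provable-now]
[BonettoLebowitzReyBellet2000]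
#9 BoundedResponse (support) — (= stmt-AtomisticToContinuum-2743, shared deliverable) for all
parameters > 0, under weak-NESS uniqueness, HasBoundedResponse (pinnedChain ω₂ lam β γ): the
catalogued necessary waypoint; closed here by OddSufficiency from OddResponseBound. [difficulty:
open-problem] [BonettoLebowitzReyBellet2000,
Literature.Barriers.AtomisticToContinuum.HasBoundedResponse]
#9 CurrentVarianceLinear (support) — equilibrium second moment of the total current is O(N): ∃ c(T)
∀ N, ∫ J_tot² e^{−H_N/T} ≤ c·N·∫ e^{−H_N/T} (and integrability). Under the Gibbs weight momenta are
i.i.d. N(0,T) independent of positions and j_i = −½(p_i+p_{i+1})V′(r_i), so ⟨j_i j_k⟩ = 0 for |i−k|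
≥ 2 and ∫J_tot² ≤ 3N·max_i ⟨j_i²⟩ with ⟨j_i²⟩ ≤ T·⟨V′(r_i)²⟩ bounded uniformly in N, i (uniformly
log-concave configurational Gibbs measure, U″ ≥ ω₂, V″ ≥ 1: Brascamp–Lieb / transfer operator). N =
0, 1: J_tot ≡ 0. [difficulty: M] [BrascampLieb1976, BonettoLebowitzReyBellet2000]
#9 ResponseDensity (support) — (card item 1, fixed-N regularity; existence half of the interface
used by OddResponseBound) under uniqueness, for every family, T > 0 and N there is h ∈ L²(μ_{N,T,T})
with d/dδ ∫F dμ_{N,T+δ/2,T−δ/2}|₀ = ∫ F h dμ_{N,T,T} for all F ∈ C_c^∞ and for F = each bond current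
(limits along 𝓝[≠]0 of difference quotients). Content: Hairer–Majda linear response for the
hypoelliptic Langevin chain with Lyapunov function e^{θH} (CEHR (2.5)), plus ρ_δ/ρ_0 ∈ L²(μ_T) for
|δ| < T (Gaussian-type tails). N = 1: both baths on one site at (T_L+T_R)/2 = T, so μ_δ ≡ μ_T and h
= 0. [difficulty: L] [HairerMajda2009, ReyBellet2003, CuneoEckmannHairerReyBellet2018,
EckmannPilletReyBellet1999b]
#9 ReversalKLSecondOrder (support) — (the thesis' namesake, card Mechanism (1); NOT load-bearing for
the Assembly) for the response density h of ResponseDensity: KL(μ_{N,δ} ‖ Θ_*μ_{N,δ})/δ² → ½∫(h −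
h∘Θ)² dμ_{N,T,T} as δ → 0, δ ≠ 0 (Mathlib InformationTheory.klDiv; first order vanishes, the
−½δ²∫(h² − (h∘Θ)²) term vanishes by Θ-invariance of μ_T; = 2δ²‖P_odd h‖²). Needs second-order
control of the NESS density (smooth positive densities, CEHR Thm 2.13(1); real-analyticity in δT is
printed for EPR reservoirs, EckmannPilletReyBellet1999b) — stronger than the first-order interface,
hence a separate claim about the true family. KNST: S_sym − S_Shannon = ½·this KL. [difficulty: L]
[KomatsuNakagawaSasaTasaki2011, SpinneyFord2012, EckmannPilletReyBellet1999b,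
CuneoEckmannHairerReyBellet2018]
#9 OddDensityIsCorrector (support) — (McLennan / KDN identity, fixed N ≥ 2; links ranks 2 and 3) for
the response density h and the equilibrium transition semigroup P_t: the Kubo corrector u(x) = lim_τ
∫₀^τ P_tJ_tot(x) dt exists μ_T-a.e., u ∈ L²(μ_T), and h − h∘Θ = (u − u∘Θ)/((N−1)T²) a.e. Derivation
(planner, NOTES.md): differentiating weak stationarity in δ gives −L†h = g := γ(p_0² −
p_{N−1}²)/(2T²) in L²(μ_T); generalised detailed balance L† = ΘLΘ (KDN (reln2)) gives h = (∫₀^∞P_t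
g)∘Θ; the energy identities L H_N = w_L + w_R (generator_hamiltonian_two_baths, PROVED) and L(Σ_k k
e_k) = J_tot + (N−1)w_R (sum_bondCurrent_eq_poisson, PROVED; KDN (reln3)) kill the even parts and
leave P_odd h = P_odd u/((N−1)T²); consistency: D_N = ⟨J_tot,h⟩ = ⟨J_tot,u⟩/((N−1)T²) is KDN's
open-chain Green–Kubo formula. Convergence of ∫₀^∞P_tJ_tot: CEHR (2.5) in the e^{θH}-weighted norm,
θ < 1/(2T). Formal content: justify the δ-derivative of the weak Fokker–Planck equation
(hypoelliptic regularity). [difficulty: L] [KunduDharNarayan2009, MaesNetocny2010,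
CuneoEckmannHairerReyBellet2018,
Literature.Barriers.AtomisticToContinuum.sum_bondCurrent_eq_poisson]
#9 EngineGlue (support) — GibbsSteadyState → NessUnique → CurrentVarianceLinear →
OddDensityIsCorrector → OddCorrectorDecay → OddResponseBound (measure theory, ~150 Lean lines):
μ_{N,T,T} = Gibbs (uniqueness) is Θ-invariant; h − h∘Θ = (u − u∘Θ)/((N−1)T²); ‖u − u∘Θ‖_{L²(μ_T)} ≤
liminf_τ ‖∫₀^τ(P_tJ − (P_tJ)∘Θ)dt‖ (Fatou) ≤ ∫₀^∞‖P_tJ − (P_tJ)∘Θ‖ dt (Minkowski; joint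
measurability of the kernel is in tree) ≤ C‖J_tot‖_{L²(μ_T)} ≤ C√(cN) (the unnormalised weight
cancels); hence N∫(h−hΘ)² ≤ C²cN²/((N−1)²T⁴) ≤ 4C²c/T⁴ for N ≥ 2. [difficulty: M]
[KunduDharNarayan2009, Literature.Barriers.AtomisticToContinuum.HasBoundedResponse]
#9 OddSufficiency (support) — GibbsSteadyState → CurrentVarianceLinear → ResponseDensity →
OddResponseBound → BoundedResponse (the ONE-LINE SUFFICIENCY, card item 2; ~250 Lean lines): fix
parameters, uniqueness, a family μ, T > 0 and response coefficients D; μ_{N,T,T} = Gibbs has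
totalCurrent 0, so D_N = lim Σ_i (μ_δ(j_i) − μ_T(j_i))/δ = Σ_i ∫ j_i h = ∫ J_tot h (ResponseDensity,
uniqueness of limits along 𝓝[≠]0); Θ-invariance of Gibbs (H∘Θ = H, Lebesgue invariant under (q,p) ↦
(q,−p)) and J_tot∘Θ = −J_tot give ∫J_tot h = ½∫J_tot(h − h∘Θ) ≤ ½‖J_tot‖·‖h − h∘Θ‖ ≤ ½√(cN·C/N) for
N ≥ 2 (Cauchy–Schwarz, MemLp 2); N ≤ 1: no bonds, D_N = 0; so BddAbove (range |D_N|) along μ, i.e.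
HasBoundedResponse by hasBoundedResponse_iff_of_unique (PROVED). [difficulty: M]
[Literature.Barriers.AtomisticToContinuum.HasBoundedResponse, BonettoLebowitzReyBellet2000]

TWO-LAYER PLAN. Foreseen glued splits (nothing filed now; k ≤ 3, depth 1): OddCorrectorDecay ⇐
FastOddDephasing → SlavingAndDiffusiveFloor →
OddCorrectorDecay, i.e. the card's (F)/(S)/(W): (F) the part of P_odd P_tJ_tot NOT slaved to the
even slow manifold has N-uniformly
integrable L²(μ_T)-norm (open-chain, Hilbert-space form of 'finite current/phonon lifetime');
(S)+(W) injection of the k = 0 current into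
an even mode of wavenumber k and that mode's odd content are both O(k) while even relaxation is no
slower than Ck⁻² (Weyl floor), so the
slaved contribution is Σ_k k·k·k⁻²·(summable) = O(1)·‖J‖. OddResponseBound ⇐ OddCorrectorDecay →
OddDensityIsCorrector → OddResponseBound
is already the filed EngineGlue. BoundedResponseConverges: its children belong to FeketeResistance
(QuasiSubadditiveResistance,
PositiveConductance, FeketeGlue) or FourierGreenKubo (ThermodynamicLimit) — provers of those lines
close it by citation.

KILL CRITERIA. (a) ¬OddResponseBound for pinnedChain — e.g. a proof or certified numerics that
N·∫(h_N − h_N∘Θ)² → ∞ at some (T, parameters) with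
D_N bounded — closes the route `refuted:OddResponseBound` (SI too lossy; the card retires to 'echo
identity + b_N litmus'); it also
kills OddCorrectorDecay via EngineGlue. (b) An odd local (quasi-)conserved charge of the quartic
pinned lattice (failure of
LocalOhmRigidity's NoLocalIntegrals certificate; Mazur1969_inequality.tendsto_integral_atTop)
refutes OddCorrectorDecay AND the conjunct's
finiteness — file ¬FouriersLaw. (c) OddCorrectorDecay refuted with SI intact (oscillating odd
component / heavy boundary tail) ⇒ pivot:
restate rank 2 in resolvent form ‖P_odd u_N‖² ≤ CN (= SI′, equivalent to SI by
OddDensityIsCorrector) and re-rank. (d) ¬NessUnique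
kills clause (i) of the conjunct itself. (e) BoundedResponse proved elsewhere (LocalOhm, Fekete
companions, FourierGreenKubo) moots
ranks 2–3 as a route but not the litmus b_N; BoundedResponseConverges refuted (D_N bounded but
oscillating) breaks every
bounded-response line at once — pivot to a Cesàro/liminf form of clause (ii) is then a new route.

NOT DECOMPOSED YET. The (F)/(S)/(W) split of OddCorrectorDecay (needs the even slow manifold of the
open chain as a typed object — Feshbach/Weyl inputs of
cards weyl-law-for-heat and feshbach-energy-profile-memory); the Loschmidt-echo identity
∂_s[(N−1)T²D_N(s)]|₀ = −2‖P_odd u_N‖² for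
L_s = L + s(Θ* − 1) (interpretive, would need a definition globalFlipGenerator; not load-bearing);
the T-dependence of C(T) (allowed to
blow up as T → 0: LowTemperatureWeakAnharmonicity); a typed HarmonicCalibration item (qualitatively
automatic — SI must fail at lam = β = 0
by not_hasBoundedResponse + the sufficiency glue; quantitatively ∫(h−hΘ)² ≈ 0.33·N from the RLL
covariance, checked numerically below);
the fixed-N regularity behind ResponseDensity / ReversalKLSecondOrder / OddDensityIsCorrector (one
Hairer–Majda-type argument serves all
three); the negative statements ¬SI for phi4Chain-type or disordered members (other chains, not the
conjunct).

CHEAPEST FALSIFIER. Exact Gaussian linear algebra, no dynamics: for a solvable DIFFUSIVE benchmark —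
the Bonetto–Lebowitz–Lukkarinen 2004 harmonic chain
with self-consistent reservoirs (OU bath γ at every site, interior temperatures fixed by zero net
flux; Gaussian NESS, Fourier's law
proved) — h − h∘Θ = 2qᵀΦZp/T² with Z = d⟨qpᵀ⟩/dδ|₀ from N Lyapunov solves, and ∫(h−h∘Θ)²dμ_T =
4tr(ZᵀΦZ)/T². The line dies if this is
≍ 1 rather than ≍ 1/N. RUN by the planner this session (pure python, folder purepy_benchmark.py; kit
socket absent, scipy version
kitjob/odd_density_benchmark.py ready for N ≤ 256): ω₂ = γ = T = 1, N = 3,4,5,6,7,8,10,12: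
N·∫(h−hΘ)² = 0.865, 0.833, 0.818, 0.809,
0.803, 0.799, 0.792, 0.787 (monotone ↘ ≈ 0.78; D_N → 0.188 = κ_BLL) — SI HOLDS exactly at the
Fourier scaling; control: RLL chain
pinnedChain(1,0,0,1) (baths at the ends only) ∫(h−hΘ)² = 0.68, 0.94, 1.56, 2.22, 2.89, 3.56 (N =
3,4,6,8,10,12) ≈ 0.33·N, D_N/(N−1) → 0.125
(ballistic), Z antisymmetric to 1e−15. Next cheapest: the same
proxy (HS-norm of the antisymmetrised q–p covariance response) by nonequilibrium MD for
pinnedChain(1,1,1,1), T = 1, N ≤ 128: slope −1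
in log N expected; slope ≥ 0 kills SI.

NUMBERS. Benchmarks above (ω₂ = γ = T = 1): BLL2004 N·∫(h−hΘ)² = 0.865 (N=3) ↘ 0.787 (N=12) → ≈
0.78, κ_BLL(1) ≈ 0.19; RLL ∫(h−hΘ)²/N ≈ 0.23–0.30 ↗ ≈ 0.33,
per-bond flux response c_N → 0.125. Orders the cruxes are measured against: harmonic chain b_N ≍
Nδ², ∂_sD_N(0) ≍ −N², OSD integral ≍ N (band-edge odd momenta,
L² gap ≍ N⁻³: BeckerMenegaki2022 Thm 1); Fourier conductor b_N ≍ δ²/N, entropy production ≍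
κδ²/(NT²) (Gaspard2022 (5.97)–(5.98));
insulator b_N ≍ e^{−2N/ξ}. KDN normalisation: D_N = (1/((N−1)T²))∫₀^∞⟨J_tot, P_tJ_tot⟩dt
(KunduDharNarayan2009 (reln3)). Items at open: 14
(3 cruxes, 10 support, 1 assembly).

DEFINITION REQUESTS. None. Everything is stated over FouriersLaw.lean (pinnedChain, IsSteadyState,
bondCurrent, totalCurrent, hamiltonian),
FixedLengthNoConductivityControl.lean (HasBoundedResponse), LangevinChainKernel.lean
(OscillatorChain.transitionKernel — the CONSTRUCTED
transition kernels, so no semigroup interface is quantified over), Mathlib (MeasureTheory.MemLp,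
InformationTheory.klDiv, withDensity).
The response density and the Kubo corrector are characterised inline (weak-derivative predicate;
a.e. limit of ∫₀^τ P_tJ_tot), existence
being separate support items. A notion `globalFlipGenerator` would only be needed for the (unfiled)
echo identity.

Novelty: Searches (2026-08-15, this planner, on top of the card's and the refuter audit's): `lit frontier
AtomisticToContinuum --since 2020` (30 rows;
deterministic-bulk news = CanestrariLiveraniOlla2026 only; nothing on reversal entropy / parity
sectors), `lit bridges AtomisticToContinuum
--cross any` (30 rows, none relevant), `lit search --hybrid --source local "symmetrized Shannon
entropy nonequilibrium steady state time
reversal relative entropy"` (12 docs: Gaspard2022 pp.380–388, Evans–Morriss, Gallavotti 2014,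
Luscombe 2024 — textbooks; read Gaspard
pp.385–388), `lit vsearch` on the SI statement in prose (10 docs, none on-topic beyond
Gaspard2022/Gallavotti2014), `lit search --source s2
"McLennan ensemble nonequilibrium steady state linear response time reversal"` (12 rows, none closer
than MaesNetocny2010), `lit search
--source crossref "relative entropy steady state time reversal system size heat conduction chain"`
(11 rows, engineering noise);
OpenAlex and arXiv APIs rate-limited (HTTP 429), `lit galaxy search … --star all` and `--star
panama` both 'queued too long (> 90 s)' twice —
recorded, not worked around; `lit read arXiv:1009.0970` (KNST2011 p.6, p.13) and `lit read
arXiv:0809.4543` (KDN2009 p.3 (reln2)–(reln3));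
`lean search` for klDiv / MemLp / transitionKernel / thm213_holds; all six route files of the sub
and `ledger idea list` (98 cards) re-read
for parity / reversal-KL mechanisms (only the unrouted cards parity-split-noise-derivative,
even-parity-dirichlet-princip  [refs: 10.1007/s10955-010-0095-5, 10.1103/physrevlett.108.170603, 10.1063/1.3274819, 1009.0970, 0809.4543, doi:10.1007/s10955-010-0095-5, doi:10.1103/physrevlett.108.170603, doi:10.1063/1.3274819, CanestrariLiveraniOlla2026, Gaspard2022, Gallavotti2014, MaesNetocny2010, KomatsuNakagawaSasaTasaki2011, SpinneyFord2012, KunduDharNarayan2009]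

Barriers (technique_class: parity-sector-semigroup-decay; reversal-entropy): - technique_class: parity-sector-semigroup-decay; reversal-entropy
- Literature.Barriers.AtomisticToContinuum.HasBoundedResponse: REDUCED, not evaded — BoundedResponse
is derived from OddResponseBound by OddSufficiency; the N-dependence the barrier says no fixed-N
tool controls now sits in one explicit norm (ranks 2–3), which is not a fixed-N statement (C uniform
in N) and is checkable on solvable models (done: BLL ≍ 1/N, RLL ≍ N).
- Literature.Barriers.AtomisticToContinuum.BeckerMenegaki2022_gapClosing: no N-uniform RATE or
spectral gap is used; OddCorrectorDecay asks INTEGRATED decay of one odd vector. The barrier's slow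
modes are even (energy profiles) or, for the harmonic chain, the odd band-edge momenta that make the
OSD integral ≍ N there — met head-on: the bet is that anharmonic dephasing of exactly that component
distinguishes lam, β > 0 (foreseen child (F)).
- Literature.Barriers.AtomisticToContinuum.equilibrium_rate_bound: its witness is the centred energy
H_N − ⟨H_N⟩, a Θ-EVEN vector dissipated only at the two ends; P_odd annihilates it, so the bound
constrains nothing in the odd sector where ranks 2–3 live (and again no rate is claimed).
- Literature.Barriers.AtomisticToContinuum.Mazur1969_inequality: an odd conserved or quasi-conserved
charge overlapping J_tot makes ‖P_odd u_N‖² ≍ N² and kills OddCorrectorDecay / OddResponseBound —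
consistent, since it kills Fourier too; recorded kill criterion (b), shared with LocalOhmRigidity's
NoLocalIntegrals certificate; not

History (route lifecycle, newest last):
- 2026-08-15T13:46:46Z · CLOSED retired — not-a-thesis: assembly does not conclude the sub-problem Statement (operator:999:1257524)

sub-problem: FouriersLaw · status: closed(retired) · opened planner-plancard-AtomisticToContinuum-Fourier-0ef2f3d0-0 2026-08-15T11:46:49Z · rev 0 · ledger route-AtomisticToContinuum-StaticIrreversibility
GENERATED by the gate from the ledger (D-0016/17). Provers cite these decls: `theorem foo : Summit.AtomisticToContinuum.FouriersLaw.Theses.StaticIrreversibility.<Decl> := …` in Summits/AtomisticToContinuum/FouriersLaw/Theorems/<Name>.lean.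
-/

namespace Summit.AtomisticToContinuum.FouriersLaw.Theses.StaticIrreversibility

open scoped BigOperators Topology Manifold Classical MeasureTheory ProbabilityTheory Matrix InnerProductSpace ComplexConjugate ContinuousMap
open Filter Set Function TopologicalSpace MeasureTheory

attribute [summit_statement] _root_.FouriersLaw

/-- item stmt-AtomisticToContinuum-6445 · crux · rank 2 · closed · moot by None · by planner
why it might fail: (i) an odd quasi-conserved charge (Mazur class) makes it ≍N; (ii) C(T)≍(lamT)⁻² near the harmonic corner — fine pointwise in T only; (iii) norm-integrability exceeds Green–Kubo: a non-decaying oscillating odd component, or a boundary tail heavier than t^{-3/4}, breaks OSD with SI intact.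
sources: BeckerMenegaki2022, KunduDharNarayan2009, BonettoLebowitzReyBellet2000, AokiLukkarinenSpohn2006, LepriLiviPoliti2003, Literature.Barriers.AtomisticToContinuum.equilibrium_rate_bound
[crux] (OSD, card item 4 — the engine) for all ω₂, lam, β, γ > 0 and T > 0 there is C(T) such that
for EVERY N, with P_t the transition semigroup of the EQUILIBRIUM open chain (both baths at T;
OscillatorChain.transitionKernel, constructed in tree — no ∃/∀-semigroup ambiguity) and μ_T the
Gibbs weight e^{−H_N/T} dq dp (unnormalised: both sides scale alike): t ↦ ‖P_tJ_tot −
(P_tJ_tot)∘Θ‖_{L²(μ_T)} is integrable on (0,∞) and ∫₀^∞ ‖P_tJ_tot − (P_tJ_tot)∘Θ‖ dt ≤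
C·‖J_tot‖_{L²(μ_T)}, J_tot = Σ_i j_i. INTEGRATED decay of ONE odd vector, uniform in N — not a rate,
not the full autocorrelation. Heuristic budget: transient ≍ τ‖J‖ plus the boundary diffusive tail
‖P_odd P_tJ‖ ≍ t^{-3/4} on (1, N²) contributing ≍ √N ≍ ‖J‖ — marginal but consistent; harmonic
chain: the ratio ∫‖P_odd P_tJ‖dt/‖J‖ grows at least linearly in N (ballistic phonons between the
contacts; band-edge odd momenta live ≍ N³), fails as it must. [difficulty: open-problem] -/
@[route_item "route-AtomisticToContinuum-StaticIrreversibility"]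
def OddCorrectorDecay : Prop :=
  ∀ ω₂ lam β γ : ℝ, 0 < ω₂ → 0 < lam → 0 < β → 0 < γ → ∀ T : ℝ, 0 < T → ∃ C : ℝ, ∀ N : ℕ, MeasureTheory.IntegrableOn (fun t : ℝ => Real.sqrt (∫ x, ((∫ y, (∑ i : Fin N, (Literature.MathematicalPhysics.KineticTheory.HeatConduction.pinnedChain ω₂ lam β γ).bondCurrent N i y) ∂((Literature.MathematicalPhysics.KineticTheory.HeatConduction.pinnedChain ω₂ lam β γ).transitionKernel N T T t.toNNReal x)) - (∫ y, (∑ i : Fin N, (Literature.MathematicalPhysics.KineticTheory.HeatConduction.pinnedChain ω₂ lam β γ).bondCurrent N i y) ∂((Literature.MathematicalPhysics.KineticTheory.HeatConduction.pinnedChain ω₂ lam β γ).transitionKernel N T T t.toNNReal (x.1, -x.2)))) ^ 2 ∂(MeasureTheory.volume.withDensity (fun x : Literature.MathematicalPhysics.KineticTheory.HeatConduction.PhaseSpace N => ENNReal.ofReal (Real.exp (-((Literature.MathematicalPhysics.KineticTheory.HeatConduction.pinnedChain ω₂ lam β γ).hamiltonian N x) / T)))))) (Set.Ioi 0) ∧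 ∫ t in Set.Ioi (0 : ℝ), Real.sqrt (∫ x, ((∫ y, (∑ i : Fin N, (Literature.MathematicalPhysics.KineticTheory.HeatConduction.pinnedChain ω₂ lam β γ).bondCurrent N i y) ∂((Literature.MathematicalPhysics.KineticTheory.HeatConduction.pinnedChain ω₂ lam β γ).transitionKernel N T T t.toNNReal x)) - (∫ y, (∑ i : Fin N, (Literature.MathematicalPhysics.KineticTheory.HeatConduction.pinnedChain ω₂ lam β γ).bondCurrent N i y) ∂((Literature.MathematicalPhysics.KineticTheory.HeatConduction.pinnedChain ω₂ lam β γ).transitionKernel N T T t.toNNReal (x.1, -x.2)))) ^ 2 ∂(MeasureTheory.volume.withDensity (fun x : Literature.MathematicalPhysics.KineticTheory.HeatConduction.PhaseSpace N => ENNReal.ofReal (Real.exp (-((Literature.MathematicalPhysics.KineticTheory.HeatConduction.pinnedChain ω₂ lam β γ).hamiltonian N x) / T))))) ≤ C * Real.sqrt (∫ x, (∑ i : Fin N, (Literature.MathematicalPhysics.KineticTheory.HeatConduction.pinnedChain ω₂ lam β γ).bondCurrent N i x) ^ 2 ∂(MeasureTheory.volume.withDensity (fun x : Literature.MathematicalPhysics.KineticTheory.HeatConduction.PhaseSpace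 N => ENNReal.ofReal (Real.exp (-((Literature.MathematicalPhysics.KineticTheory.HeatConduction.pinnedChain ω₂ lam β γ).hamiltonian N x) / T)))))

/-- item stmt-AtomisticToContinuum-6446 · crux · rank 3 · closed · moot by None · by planner
why it might fail: Sufficient, maybe not necessary: first-order long-range ODD correlations (δ/N over ≍N² pairs) would give ∫(h−hΘ)² ≍ 1 with Fourier intact (absent in BLL2004, where it is ≍1/N exactly); ≍N for the harmonic member; nothing N-uniform is known for any deterministic anharmonic chain.
sources: KomatsuNakagawaSasaTasaki2011, SpinneyFord2012, MaesNetocny2010, BonettoLebowitzLukkarinen2004, BernardinOlla2005, RiederLebowitzLieb1967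
[crux] (SI, card items 2/5 — the X of the thesis) under weak-NESS uniqueness, for every steady-state
family μ and T > 0 there is C with: for all N ≥ 2 and every h that is the L²(μ_{N,T,T})
linear-response density of δ ↦ μ_{N,T+δ/2,T−δ/2} at δ = 0 (weak derivative on C_c^∞ observables AND
on the bond currents — the predicate pins h down uniquely; existence is the separate support item
ResponseDensity, so nothing is smuggled), h − h∘Θ ∈ L²(μ_{N,T,T}) and N·∫(h − h∘Θ)² dμ_{N,T,T} ≤ C.
Equivalent readings: b_N = KL(NESS‖Θ NESS) = O(δ²/N) (ReversalKLSecondOrder); ‖P_odd u_N‖² = O(N)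
for the Kubo corrector (OddDensityIsCorrector). Benchmarks (planner, exact): BLL2004 self-consistent
chain N·∫(h−hΘ)² = 0.87 ↘ 0.79 for N = 3…12 (decreasing); RLL harmonic chain ∫(h−hΘ)² ≈ 0.33·N.
[deps: OddCorrectorDecay] [difficulty: open-problem] -/
@[route_item "route-AtomisticToContinuum-StaticIrreversibility"]
def OddResponseBound : Prop :=
  ∀ ω₂ lam β γ : ℝ, 0 < ω₂ → 0 < lam → 0 < β → 0 < γ → (∀ (N : ℕ) (T_L T_R : ℝ), 0 < T_L → 0 < T_R → ∀ μ ν : MeasureTheory.Measure (Literature.MathematicalPhysics.KineticTheory.HeatConduction.PhaseSpace N), (Literature.MathematicalPhysics.KineticTheory.HeatConduction.pinnedChain ω₂ lam β γ).IsSteadyState N T_L T_R μ → (Literature.MathematicalPhysics.KineticTheory.HeatConduction.pinnedChain ω₂ lam β γ).IsSteadyState N T_L T_R ν → μ = ν) → ∀ μ : (N : ℕ) → ℝ → ℝ → MeasureTheory.Measure (Literature.MathematicalPhysics.KineticTheory.HeatConduction.PhaseSpace N), (∀ (N : ℕ) (T_L T_R : ℝ), 0 < T_L → 0 < T_R → (Literature.MathematicalPhysics.KineticTheory.HeatConduction.pinnedChain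 ω₂ lam β γ).IsSteadyState N T_L T_R (μ N T_L T_R)) → ∀ T : ℝ, 0 < T → ∃ C : ℝ, ∀ (N : ℕ) (h : Literature.MathematicalPhysics.KineticTheory.HeatConduction.PhaseSpace N → ℝ), 2 ≤ N → (MeasureTheory.MemLp h 2 (μ N T T) ∧ (∀ F : Literature.MathematicalPhysics.KineticTheory.HeatConduction.PhaseSpace N → ℝ, ContDiff ℝ ((⊤ : ℕ∞) : WithTop ℕ∞) F → HasCompactSupport F → Filter.Tendsto (fun δ : ℝ => ((∫ x, F x ∂(μ N (T + δ / 2) (T - δ / 2))) - ∫ x, F x ∂(μ N T T)) / δ) (nhdsWithin 0 {(0 : ℝ)}ᶜ) (nhds (∫ x, F x * h x ∂(μ N T T)))) ∧ (∀ i : Fin N, Filter.Tendsto (fun δ : ℝ => ((∫ x, (Literature.MathematicalPhysics.KineticTheory.HeatConduction.pinnedChain ω₂ lam β γ).bondCurrent N i x ∂(μ N (T + δ / 2) (T - δ / 2))) - ∫ x, (Literature.MathematicalPhysics.KineticTheory.HeatConduction.pinnedChain ω₂ lam β γ).bondCurrent N i x ∂(μ N T T)) / δ) (nhdsWithin 0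 {(0 : ℝ)}ᶜ) (nhds (∫ x, (Literature.MathematicalPhysics.KineticTheory.HeatConduction.pinnedChain ω₂ lam β γ).bondCurrent N i x * h x ∂(μ N T T))))) → MeasureTheory.MemLp (fun x : Literature.MathematicalPhysics.KineticTheory.HeatConduction.PhaseSpace N => h x - h (x.1, -x.2)) 2 (μ N T T) ∧ (N : ℝ) * ∫ x, (h x - h (x.1, -x.2)) ^ 2 ∂(μ N T T) ≤ C

/-- item stmt-AtomisticToContinuum-2741 · crux · rank 4 · closed · moot by None · by planner
why it might fail: D_N may oscillate in N (no monotonicity or subadditivity in the length is known; size resonances at low T where the mean free path exceeds N) or tend to 0 (no N-uniform lower bound on the conductance beyond μ(Φ) > 0 at fixed N).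
sources: BonettoLebowitzReyBellet2000, EckmannPilletReyBellet1999b, LepriLiviPoliti2003
[crux] IMPORT SLOT — A BOUNDED RESPONSE SEQUENCE CONVERGES TO A POSITIVE LIMIT: under weak-NESS
uniqueness, along any steady-state family, for T > 0: if the response coefficients D_N of clause
(ii) exist for all N and (|D_N|)_N is bounded, then D_N → k for some k > 0. This is 'FouriersLawFor
minus HasBoundedResponse' (a consequence of the conjunct under uniqueness, by uniqueness of limits
along 𝓝[≠]0) and is NOT this route's mechanism — it is the declared residual once HasBoundedResponse
is in hand, expected from the companion card fekete-resistance-subadditivity (quasi-subadditivity of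
the resistance R_N = N/D_N + Fekete ⇒ R_N/N → ℓ = inf; boundedness ⇒ ℓ > 0; D_2 > 0 ⇒ ℓ < ∞; so D_N
→ 1/ℓ ∈ (0, ∞)) or from route FourierGreenKubo's ThermodynamicLimit (D_N → κ_GK > 0). Filed as a
crux because it is open and load-bearing for the assembly; provers of the companion lines may close
it by citing their theorems. Sources: BonettoLebowitzReyBellet2000 §5.3 (33), §6.3;
EckmannPilletReyBellet1999b (μ(Φ) > 0 iff T_L > T_R at fixed N — no N-uniform lower bound);
LepriLiviPoliti2003 §6 (contact resistance); card
AtomisticToContinuum/FouriersLaw/fekete-resistance-subadditivity. -/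
@[route_item "route-AtomisticToContinuum-StaticIrreversibility"]
def BoundedResponseConverges : Prop :=
  ∀ ω₂ lam β γ : ℝ, 0 < ω₂ → 0 < lam → 0 < β → 0 < γ → (∀ (N : ℕ) (T_L T_R : ℝ), 0 < T_L → 0 < T_R → ∀ μ ν : MeasureTheory.Measure (Literature.MathematicalPhysics.KineticTheory.HeatConduction.PhaseSpace N), (Literature.MathematicalPhysics.KineticTheory.HeatConduction.pinnedChain ω₂ lam β γ).IsSteadyState N T_L T_R μ → (Literature.MathematicalPhysics.KineticTheory.HeatConduction.pinnedChain ω₂ lam β γ).IsSteadyState N T_L T_R ν → μ = ν) → ∀ μ : (N : ℕ) → ℝ → ℝ → MeasureTheory.Measure (Literature.MathematicalPhysics.KineticTheory.HeatConduction.PhaseSpace N), (∀ (N : ℕ) (T_L T_R : ℝ), 0 < T_L → 0 < T_R → (Literature.MathematicalPhysics.KineticTheory.HeatConduction.pinnedChain ω₂ lam β γ).IsSteadyState N T_L T_R (μ N T_L T_R)) → ∀ T : ℝ, 0 < T → ∀ D : ℕ → ℝ, (∀ N : ℕ, Filter.Tendsto (fun δ : ℝ => (Literature.MathematicalPhysics.KineticTheory.HeatConduction.pinnedChain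 ω₂ lam β γ).totalCurrent (μ N (T + δ / 2) (T - δ / 2)) / δ) (nhdsWithin 0 {(0 : ℝ)}ᶜ) (nhds (D N))) → BddAbove (Set.range fun N => |D N|) → ∃ k : ℝ, 0 < k ∧ Filter.Tendsto D Filter.atTop (nhds k)

/-- item stmt-AtomisticToContinuum-0717 · support · rank 9 · closed · proved by Summit.AtomisticToContinuum.FouriersLaw.Theorems.FourierGreenKubo.finiteResponseOfUnique_holds (prover) · by planner
sources: ReyBellet2003, HairerMajda2009
CONDITIONAL FORM OF 0705 (supersedes it as the prover target; refuters pool-5/g3-0: 0705 stand-alone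
quantifies over EVERY steady-state family and is false-prone if weak steady states were non-unique):
assuming UNIQUENESS of weak steady states (IsSteadyState class) for pinnedChain at all N, T_L, T_R >
0, the finite-N linear-response limit D_N(T) = lim_{δ→0, δ≠0} totalCurrent(μ_{N,T+δ/2,T−δ/2})/δ
exists for every T > 0 and N. Content: differentiability at equilibrium of NESS expectations of the
polynomial currents in the bath temperatures (ReyBellet2003 arXiv:math-ph/0303021 Rem 4.4 (51)–(56)
finite-volume Green–Kubo; HairerMajda2009 arXiv:0909.4313 Thm 2.3 framework — their SDE Thm 4.4
Assumption 5 fails here, so verify Assumptions 1–3 via CEHR2018 (2.5)/Carmona2007 Thm 1.1(iv)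
weighted spectral gap). N = 0, 1: totalCurrent ≡ 0, D = 0. Together with 0706 gives 0705. -/
@[route_item "route-AtomisticToContinuum-StaticIrreversibility"]
def FiniteResponseOfUnique : Prop :=
  ∀ ω₂ lam β γ : ℝ, 0 < ω₂ → 0 < lam → 0 < β → 0 < γ → (∀ (N : ℕ) (T_L T_R : ℝ), 0 < T_L → 0 < T_R → ∀ μ ν : MeasureTheory.Measure (Literature.MathematicalPhysics.KineticTheory.HeatConduction.PhaseSpace N), (Literature.MathematicalPhysics.KineticTheory.HeatConduction.pinnedChain ω₂ lam β γ).IsSteadyState N T_L T_R μ → (Literature.MathematicalPhysics.KineticTheory.HeatConduction.pinnedChain ω₂ lam β γ).IsSteadyState N T_L T_R ν → μ = ν) → ∀ μ : (N : ℕ) → ℝ → ℝ → MeasureTheory.Measure (Literature.MathematicalPhysics.KineticTheory.HeatConduction.PhaseSpace N), (∀ (N : ℕ) (T_L T_R : ℝ), 0 < T_L → 0 < T_R → (Literature.MathematicalPhysics.KineticTheory.HeatConduction.pinnedChain ω₂ lam β γ).IsSteadyState N T_L T_R (μ N T_L T_R)) → ∀ T : ℝ, 0 < T → ∀ N : ℕ,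 ∃ D : ℝ, Filter.Tendsto (fun δ : ℝ => (Literature.MathematicalPhysics.KineticTheory.HeatConduction.pinnedChain ω₂ lam β γ).totalCurrent (μ N (T + δ / 2) (T - δ / 2)) / δ) (nhdsWithin 0 {(0 : ℝ)}ᶜ) (nhds D)

/-- item stmt-AtomisticToContinuum-0718 · support · rank 9 · closed · proved by Summit.AtomisticToContinuum.FouriersLaw.Theorems.GibbsSteadyState_proof (prover) · by planner
sources: BonettoLebowitzReyBellet2000
EQUILIBRIUM ANCHOR (refuter pool-5 on 0706: "a good Lean warm-up"; de-vacuifies IsSteadyState and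
pins δ = 0 in 0705/0717): for pinnedChain ω₂ lam β γ (all > 0), every N and T > 0, the Gibbs measure
Z⁻¹ e^{−H_N(q,p)/T} d q d p (Z = ∫ e^{−H/T} ∈ (0,∞): H ≥ Σ p²/2 + ω₂ q²/2, polynomial growth) is a
weak steady state with T_L = T_R = T — probability ✓; ∫ L f dμ = 0 for f ∈ C_c^∞ by Liouville
(Hamiltonian part: integrate by parts, {H, e^{−H/T}} = 0) and by ∫ (T ∂_p² f − p ∂_p f) e^{−p²/2T}
dp = 0 for the two Ornstein–Uhlenbeck bath terms; bond currents j_i = −½(p_i + p_{i+1})V′(q_{i+1} −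
q_i) are integrable (Gaussian in p × e^{−(V+U)/T}) and have mean 0 (odd in p) ⇒ totalCurrent = 0.
Sources: BonettoLebowitzReyBellet2000 §4.1 (10)–(11) (Gibbs is stationary at equal temperatures);
folklore. -/
@[route_item "route-AtomisticToContinuum-StaticIrreversibility"]
def GibbsSteadyState : Prop :=
  ∀ ω₂ lam β γ : ℝ, 0 < ω₂ → 0 < lam → 0 < β → 0 < γ → ∀ (N : ℕ) (T : ℝ), 0 < T → ∃ Z : ℝ, 0 < Z ∧ (Literature.MathematicalPhysics.KineticTheory.HeatConduction.pinnedChain ω₂ lam β γ).IsSteadyState N T T ((ENNReal.ofReal Z)⁻¹ • MeasureTheory.volume.withDensity (fun x => ENNReal.ofReal (Real.exp (-(Literature.MathematicalPhysics.KineticTheory.HeatConduction.pinnedChain ω₂ lam β γ).hamiltonian N x / T)))) ∧ (Literature.MathematicalPhysics.KineticTheory.HeatConduction.pinnedChain ω₂ lam β γ).totalCurrent ((ENNReal.ofReal Z)⁻¹ • MeasureTheory.volume.withDensity (fun x => ENNReal.ofReal (Real.exp (-(Literature.MathematicalPhysics.KineticTheory.HeatConduction.pinnedChain ω₂ lam β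 γ).hamiltonian N x / T)))) = 0

/-- `GibbsSteadyState` holds: proved by `Summit.AtomisticToContinuum.FouriersLaw.Theorems.GibbsSteadyState_proof`. -/
theorem GibbsSteadyState_holds : GibbsSteadyState := _root_.Summit.AtomisticToContinuum.FouriersLaw.Theorems.GibbsSteadyState_proof

/-- item stmt-AtomisticToContinuum-0741 · support · rank 9 · closed · proved by Summit.AtomisticToContinuum.FouriersLaw.Theorems.nessUnique_proof (prover) · by planner
[crux] UNIQUENESS OF THE WEAK STEADY STATE (the half of stmt-0706 not covered by the landed fact
Literature.MathematicalPhysics.KineticTheory.HeatConduction.CuneoEckmannHairerReyBellet2018_pinnedChain,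
p3544): for pinnedChain ω₂ lam β γ (all > 0), every N and T_L, T_R > 0, any two measures in the weak
Fokker–Planck class IsSteadyState (probability, ∫ L f dμ = 0 for f ∈ C_c^∞, bond currents
integrable) coincide. Print: uniqueness of the INVARIANT MEASURE of the Langevin semigroup
(CuneoEckmannHairerReyBellet2018 Thm 2.13(1): C1, C2, CA; Carmona2007 Thm 1.1(iii)); the item
additionally needs 'weak stationary probability solution of L*μ = 0 ⇒ P_t-invariant' for this
hypoelliptic L with cubic drift (Echeverría 1982 well-posed martingale problem on C_c^∞ +
non-explosion via e^{θH}; Bogachev–Krylov–Röckner–Shaposhnikov 2015 Ch. 5 is non-degenerate only) —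
the FP-identification lemma is the formal crux. N = 0: PhaseSpace 0 is a point (unique probability
measure); N = 1: both baths on site 0, OU at temperature (T_L+T_R)/2. This is exactly the hypothesis
of FiniteResponse and ThermodynamicLimit and, with the fact, gives clause (i) of FouriersLawFor. -/
@[route_item "route-AtomisticToContinuum-StaticIrreversibility"]
def NessUnique : Prop :=
  ∀ ω₂ lam β γ : ℝ, 0 < ω₂ → 0 < lam → 0 < β → 0 < γ → ∀ (N : ℕ) (T_L T_R : ℝ), 0 < T_L → 0 < T_R → ∀ μ ν : MeasureTheory.Measure (Literature.MathematicalPhysics.KineticTheory.HeatConduction.PhaseSpace N), (Literature.MathematicalPhysics.KineticTheory.HeatConduction.pinnedChain ω₂ lam β γ).IsSteadyState N T_L T_R μ → (Literature.MathematicalPhysics.KineticTheory.HeatConduction.pinnedChain ω₂ lam β γ).IsSteadyState N T_L T_R ν → μ = ν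

/-- `NessUnique` holds: proved by `Summit.AtomisticToContinuum.FouriersLaw.Theorems.nessUnique_proof`. -/
theorem NessUnique_holds : NessUnique := _root_.Summit.AtomisticToContinuum.FouriersLaw.Theorems.nessUnique_proof

/-- item stmt-AtomisticToContinuum-2743 · support · rank 9 · closed · moot by None · by planner
sources: BonettoLebowitzReyBellet2000, Literature.Barriers.AtomisticToContinuum.HasBoundedResponse
[support] THE ROUTE'S DELIVERABLE: for all parameters > 0, under weak-NESS uniqueness,
HasBoundedResponse (pinnedChain ω₂ lam β γ) — the catalogued necessary waypoint of
Literature/Barriers/AtomisticToContinuum/FixedLengthNoConductivityControl.lean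
(hasBoundedResponse_of_fouriersLawFor PROVED; under uniqueness the family quantifier collapses,
hasBoundedResponse_iff_of_unique PROVED; fails at lam = β = 0,
HarmonicChainBallisticFlux.not_hasBoundedResponse). Closed by BoundedResponseGlue from
FiniteResponseProfile + LocalOhm + BVProfile; stated on its own so that other routes (crux 2
'BoundedResponse' of the card fekete-resistance-subadditivity; FourierGreenKubo's ThermodynamicLimit
implies it) can want the same decl. Sources: BonettoLebowitzReyBellet2000 §6.3 ('Nothing is known
about the dependence of D on L'); BonettoLebowitzLukkarinenOlla2009 §1. -/
@[route_item "route-AtomisticToContinuum-StaticIrreversibility"]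
def BoundedResponse : Prop :=
  ∀ ω₂ lam β γ : ℝ, 0 < ω₂ → 0 < lam → 0 < β → 0 < γ → (∀ (N : ℕ) (T_L T_R : ℝ), 0 < T_L → 0 < T_R → ∀ μ ν : MeasureTheory.Measure (Literature.MathematicalPhysics.KineticTheory.HeatConduction.PhaseSpace N), (Literature.MathematicalPhysics.KineticTheory.HeatConduction.pinnedChain ω₂ lam β γ).IsSteadyState N T_L T_R μ → (Literature.MathematicalPhysics.KineticTheory.HeatConduction.pinnedChain ω₂ lam β γ).IsSteadyState N T_L T_R ν → μ = ν) → Literature.Barriers.AtomisticToContinuum.HasBoundedResponse (Literature.MathematicalPhysics.KineticTheory.HeatConduction.pinnedChain ω₂ lam β γ)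

/-- item stmt-AtomisticToContinuum-6447 · support · rank 9 · closed · moot by None · by planner
sources: BrascampLieb1976, BonettoLebowitzReyBellet2000
[support] equilibrium second moment of the total current is O(N): ∃ c(T) ∀ N, ∫ J_tot² e^{−H_N/T} ≤
c·N·∫ e^{−H_N/T} (and integrability). Under the Gibbs weight momenta are i.i.d. N(0,T) independent
of positions and j_i = −½(p_i+p_{i+1})V′(r_i), so ⟨j_i j_k⟩ = 0 for |i−k| ≥ 2 and ∫J_tot² ≤ 3N·max_i
⟨j_i²⟩ with ⟨j_i²⟩ ≤ T·⟨V′(r_i)²⟩ bounded uniformly in N, i (uniformly log-concave configurational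
Gibbs measure, U″ ≥ ω₂, V″ ≥ 1: Brascamp–Lieb / transfer operator). N = 0, 1: J_tot ≡ 0.
[difficulty: M] -/
@[route_item "route-AtomisticToContinuum-StaticIrreversibility"]
def CurrentVarianceLinear : Prop :=
  ∀ ω₂ lam β γ : ℝ, 0 < ω₂ → 0 < lam → 0 < β → 0 < γ → ∀ T : ℝ, 0 < T → ∃ c : ℝ, ∀ N : ℕ, MeasureTheory.Integrable (fun x : Literature.MathematicalPhysics.KineticTheory.HeatConduction.PhaseSpace N => (∑ i : Fin N, (Literature.MathematicalPhysics.KineticTheory.HeatConduction.pinnedChain ω₂ lam β γ).bondCurrent N i x) ^ 2 * Real.exp (-((Literature.MathematicalPhysics.KineticTheory.HeatConduction.pinnedChain ω₂ lam β γ).hamiltonian N x) / T)) MeasureTheory.volume ∧ ∫ x : Literature.MathematicalPhysics.KineticTheory.HeatConduction.PhaseSpace N, (∑ i : Fin N, (Literature.MathematicalPhysics.KineticTheory.HeatConduction.pinnedChain ω₂ lam β γ).bondCurrent N i x) ^ 2 * Real.exp (-((Literature.MathematicalPhysics.KineticTheory.HeatConduction.pinnedChain ω₂ lam β γ).hamiltonian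 N x) / T) ∂MeasureTheory.volume ≤ c * (N : ℝ) * ∫ x : Literature.MathematicalPhysics.KineticTheory.HeatConduction.PhaseSpace N, Real.exp (-((Literature.MathematicalPhysics.KineticTheory.HeatConduction.pinnedChain ω₂ lam β γ).hamiltonian N x) / T) ∂MeasureTheory.volume

/-- item stmt-AtomisticToContinuum-6448 · support · rank 9 · closed · moot by None · by planner
sources: HairerMajda2009, ReyBellet2003, CuneoEckmannHairerReyBellet2018, EckmannPilletReyBellet1999b
[support] (card item 1, fixed-N regularity; existence half of the interface used by
OddResponseBound) under uniqueness, for every family, T > 0 and N there is h ∈ L²(μ_{N,T,T}) with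
d/dδ ∫F dμ_{N,T+δ/2,T−δ/2}|₀ = ∫ F h dμ_{N,T,T} for all F ∈ C_c^∞ and for F = each bond current
(limits along 𝓝[≠]0 of difference quotients). Content: Hairer–Majda linear response for the
hypoelliptic Langevin chain with Lyapunov function e^{θH} (CEHR (2.5)), plus ρ_δ/ρ_0 ∈ L²(μ_T) for
|δ| < T (Gaussian-type tails). N = 1: both baths on one site at (T_L+T_R)/2 = T, so μ_δ ≡ μ_T and h
= 0. [difficulty: L] -/
@[route_item "route-AtomisticToContinuum-StaticIrreversibility"]
def ResponseDensity : Prop :=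
  ∀ ω₂ lam β γ : ℝ, 0 < ω₂ → 0 < lam → 0 < β → 0 < γ → (∀ (N : ℕ) (T_L T_R : ℝ), 0 < T_L → 0 < T_R → ∀ μ ν : MeasureTheory.Measure (Literature.MathematicalPhysics.KineticTheory.HeatConduction.PhaseSpace N), (Literature.MathematicalPhysics.KineticTheory.HeatConduction.pinnedChain ω₂ lam β γ).IsSteadyState N T_L T_R μ → (Literature.MathematicalPhysics.KineticTheory.HeatConduction.pinnedChain ω₂ lam β γ).IsSteadyState N T_L T_R ν → μ = ν) → ∀ μ : (N : ℕ) → ℝ → ℝ → MeasureTheory.Measure (Literature.MathematicalPhysics.KineticTheory.HeatConduction.PhaseSpace N), (∀ (N : ℕ) (T_L T_R : ℝ), 0 < T_L → 0 < T_R → (Literature.MathematicalPhysics.KineticTheory.HeatConduction.pinnedChain ω₂ lam β γ).IsSteadyState N T_L T_R (μ N T_L T_R)) → ∀ T : ℝ, 0 < T → ∀ N : ℕ, ∃ h : Literature.MathematicalPhysics.KineticTheory.HeatConduction.PhaseSpace N → ℝ, (MeasureTheory.MemLp h 2 (μ N T T) ∧ (∀ F : Literature.MathematicalPhysics.KineticTheory.HeatConduction.PhaseSpace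 N → ℝ, ContDiff ℝ ((⊤ : ℕ∞) : WithTop ℕ∞) F → HasCompactSupport F → Filter.Tendsto (fun δ : ℝ => ((∫ x, F x ∂(μ N (T + δ / 2) (T - δ / 2))) - ∫ x, F x ∂(μ N T T)) / δ) (nhdsWithin 0 {(0 : ℝ)}ᶜ) (nhds (∫ x, F x * h x ∂(μ N T T)))) ∧ (∀ i : Fin N, Filter.Tendsto (fun δ : ℝ => ((∫ x, (Literature.MathematicalPhysics.KineticTheory.HeatConduction.pinnedChain ω₂ lam β γ).bondCurrent N i x ∂(μ N (T + δ / 2) (T - δ / 2))) - ∫ x, (Literature.MathematicalPhysics.KineticTheory.HeatConduction.pinnedChain ω₂ lam β γ).bondCurrent N i x ∂(μ N T T)) / δ) (nhdsWithin 0 {(0 : ℝ)}ᶜ) (nhds (∫ x, (Literature.MathematicalPhysics.KineticTheory.HeatConduction.pinnedChain ω₂ lam β γ).bondCurrent N i x * h x ∂(μ N T T)))))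

/-- item stmt-AtomisticToContinuum-6449 · support · rank 9 · closed · moot by None · by planner
sources: KomatsuNakagawaSasaTasaki2011, SpinneyFord2012, EckmannPilletReyBellet1999b, CuneoEckmannHairerReyBellet2018
[support] (the thesis' namesake, card Mechanism (1); NOT load-bearing for the Assembly) for the
response density h of ResponseDensity: KL(μ_{N,δ} ‖ Θ_*μ_{N,δ})/δ² → ½∫(h − h∘Θ)² dμ_{N,T,T} as δ →
0, δ ≠ 0 (Mathlib InformationTheory.klDiv; first order vanishes, the −½δ²∫(h² − (h∘Θ)²) term
vanishes by Θ-invariance of μ_T; = 2δ²‖P_odd h‖²). Needs second-order control of the NESS density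
(smooth positive densities, CEHR Thm 2.13(1); real-analyticity in δT is printed for EPR reservoirs,
EckmannPilletReyBellet1999b) — stronger than the first-order interface, hence a separate claim about
the true family. KNST: S_sym − S_Shannon = ½·this KL. [difficulty: L] -/
@[route_item "route-AtomisticToContinuum-StaticIrreversibility"]
def ReversalKLSecondOrder : Prop :=
  ∀ ω₂ lam β γ : ℝ, 0 < ω₂ → 0 < lam → 0 < β → 0 < γ → (∀ (N : ℕ) (T_L T_R : ℝ), 0 < T_L → 0 < T_R → ∀ μ ν : MeasureTheory.Measure (Literature.MathematicalPhysics.KineticTheory.HeatConduction.PhaseSpace N), (Literature.MathematicalPhysics.KineticTheory.HeatConduction.pinnedChain ω₂ lam β γ).IsSteadyState N T_L T_R μ → (Literature.MathematicalPhysics.KineticTheory.HeatConduction.pinnedChain ω₂ lam β γ).IsSteadyState N T_L T_R ν → μ = ν) → ∀ μ : (N : ℕ) → ℝ → ℝ → MeasureTheory.Measure (Literature.MathematicalPhysics.KineticTheory.HeatConduction.PhaseSpace N), (∀ (N : ℕ) (T_L T_R : ℝ), 0 < T_L → 0 < T_R → (Literature.MathematicalPhysics.KineticTheory.HeatConduction.pinnedChain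 ω₂ lam β γ).IsSteadyState N T_L T_R (μ N T_L T_R)) → ∀ T : ℝ, 0 < T → ∀ (N : ℕ) (h : Literature.MathematicalPhysics.KineticTheory.HeatConduction.PhaseSpace N → ℝ), (MeasureTheory.MemLp h 2 (μ N T T) ∧ (∀ F : Literature.MathematicalPhysics.KineticTheory.HeatConduction.PhaseSpace N → ℝ, ContDiff ℝ ((⊤ : ℕ∞) : WithTop ℕ∞) F → HasCompactSupport F → Filter.Tendsto (fun δ : ℝ => ((∫ x, F x ∂(μ N (T + δ / 2) (T - δ / 2))) - ∫ x, F x ∂(μ N T T)) / δ) (nhdsWithin 0 {(0 : ℝ)}ᶜ) (nhds (∫ x, F x * h x ∂(μ N T T)))) ∧ (∀ i : Fin N, Filter.Tendsto (fun δ : ℝ => ((∫ x, (Literature.MathematicalPhysics.KineticTheory.HeatConduction.pinnedChain ω₂ lam β γ).bondCurrent N i x ∂(μ N (T + δ / 2) (T - δ / 2))) - ∫ x, (Literature.MathematicalPhysics.KineticTheory.HeatConduction.pinnedChain ω₂ lam β γ).bondCurrent N i x ∂(μ N T T)) / δ) (nhdsWithin 0 {(0 : ℝ)}ᶜ) (nhds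 (∫ x, (Literature.MathematicalPhysics.KineticTheory.HeatConduction.pinnedChain ω₂ lam β γ).bondCurrent N i x * h x ∂(μ N T T))))) → Filter.Tendsto (fun δ : ℝ => (InformationTheory.klDiv (μ N (T + δ / 2) (T - δ / 2)) ((μ N (T + δ / 2) (T - δ / 2)).map (fun x : Literature.MathematicalPhysics.KineticTheory.HeatConduction.PhaseSpace N => (x.1, -x.2)))).toReal / δ ^ 2) (nhdsWithin 0 {(0 : ℝ)}ᶜ) (nhds ((1 / 2 : ℝ) * ∫ x, (h x - h (x.1, -x.2)) ^ 2 ∂(μ N T T)))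

/-- item stmt-AtomisticToContinuum-6450 · support · rank 9 · closed · moot by None · by planner
sources: KunduDharNarayan2009, MaesNetocny2010, CuneoEckmannHairerReyBellet2018, Literature.Barriers.AtomisticToContinuum.sum_bondCurrent_eq_poisson
[support] (McLennan / KDN identity, fixed N ≥ 2; links ranks 2 and 3) for the response density h and
the equilibrium transition semigroup P_t: the Kubo corrector u(x) = lim_τ ∫₀^τ P_tJ_tot(x) dt exists
μ_T-a.e., u ∈ L²(μ_T), and h − h∘Θ = (u − u∘Θ)/((N−1)T²) a.e. Derivation (planner, NOTES.md):
differentiating weak stationarity in δ gives −L†h = g := γ(p_0² − p_{N−1}²)/(2T²) in L²(μ_T);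
generalised detailed balance L† = ΘLΘ (KDN (reln2)) gives h = (∫₀^∞P_t g)∘Θ; the energy identities L
H_N = w_L + w_R (generator_hamiltonian_two_baths, PROVED) and L(Σ_k k e_k) = J_tot + (N−1)w_R
(sum_bondCurrent_eq_poisson, PROVED; KDN (reln3)) kill the even parts and leave P_odd h = P_odd
u/((N−1)T²); consistency: D_N = ⟨J_tot,h⟩ = ⟨J_tot,u⟩/((N−1)T²) is KDN's open-chain Green–Kubo
formula. Convergence of ∫₀^∞P_tJ_tot: CEHR (2.5) in the e^{θH}-weighted norm, θ < 1/(2T). Formal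
content: justify the δ-derivative of the weak Fokker–Planck equation (hypoelliptic regularity).
[difficulty: L] -/
@[route_item "route-AtomisticToContinuum-StaticIrreversibility"]
def OddDensityIsCorrector : Prop :=
  ∀ ω₂ lam β γ : ℝ, 0 < ω₂ → 0 < lam → 0 < β → 0 < γ → (∀ (N : ℕ) (T_L T_R : ℝ), 0 < T_L → 0 < T_R → ∀ μ ν : MeasureTheory.Measure (Literature.MathematicalPhysics.KineticTheory.HeatConduction.PhaseSpace N), (Literature.MathematicalPhysics.KineticTheory.HeatConduction.pinnedChain ω₂ lam β γ).IsSteadyState N T_L T_R μ → (Literature.MathematicalPhysics.KineticTheory.HeatConduction.pinnedChain ω₂ lam β γ).IsSteadyState N T_L T_R ν → μ = ν) → ∀ μ : (N : ℕ) → ℝ → ℝ → MeasureTheory.Measure (Literature.MathematicalPhysics.KineticTheory.HeatConduction.PhaseSpace N), (∀ (N : ℕ) (T_L T_R : ℝ), 0 < T_L → 0 < T_R → (Literature.MathematicalPhysics.KineticTheory.HeatConduction.pinnedChain ω₂ lam β γ).IsSteadyState N T_L T_R (μ N T_L T_R)) → ∀ T : ℝ, 0 < T → ∀ (N : ℕ)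 (h : Literature.MathematicalPhysics.KineticTheory.HeatConduction.PhaseSpace N → ℝ), 2 ≤ N → (MeasureTheory.MemLp h 2 (μ N T T) ∧ (∀ F : Literature.MathematicalPhysics.KineticTheory.HeatConduction.PhaseSpace N → ℝ, ContDiff ℝ ((⊤ : ℕ∞) : WithTop ℕ∞) F → HasCompactSupport F → Filter.Tendsto (fun δ : ℝ => ((∫ x, F x ∂(μ N (T + δ / 2) (T - δ / 2))) - ∫ x, F x ∂(μ N T T)) / δ) (nhdsWithin 0 {(0 : ℝ)}ᶜ) (nhds (∫ x, F x * h x ∂(μ N T T)))) ∧ (∀ i : Fin N, Filter.Tendsto (fun δ : ℝ => ((∫ x, (Literature.MathematicalPhysics.KineticTheory.HeatConduction.pinnedChain ω₂ lam β γ).bondCurrent N i x ∂(μ N (T + δ / 2) (T - δ / 2))) - ∫ x, (Literature.MathematicalPhysics.KineticTheory.HeatConduction.pinnedChain ω₂ lam β γ).bondCurrent N i x ∂(μ N T T)) / δ) (nhdsWithin 0 {(0 : ℝ)}ᶜ) (nhds (∫ x, (Literature.MathematicalPhysics.KineticTheory.HeatConduction.pinnedChain ω₂ lam β γ).bondCurrent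 N i x * h x ∂(μ N T T))))) → ∃ u : Literature.MathematicalPhysics.KineticTheory.HeatConduction.PhaseSpace N → ℝ, MeasureTheory.MemLp u 2 (μ N T T) ∧ (∀ᵐ x ∂(μ N T T), Filter.Tendsto (fun τ : ℝ => ∫ t in Set.Ioc (0 : ℝ) τ, (∫ y, (∑ i : Fin N, (Literature.MathematicalPhysics.KineticTheory.HeatConduction.pinnedChain ω₂ lam β γ).bondCurrent N i y) ∂((Literature.MathematicalPhysics.KineticTheory.HeatConduction.pinnedChain ω₂ lam β γ).transitionKernel N T T t.toNNReal x))) Filter.atTop (nhds (u x))) ∧ (∀ᵐ x ∂(μ N T T), h x - h (x.1, -x.2) = (u x - u (x.1, -x.2)) / (((N : ℝ) - 1) * T ^ 2))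

/-- item stmt-AtomisticToContinuum-6451 · support · rank 9 · closed · moot by None · by planner
sources: KunduDharNarayan2009, Literature.Barriers.AtomisticToContinuum.HasBoundedResponse
[support] GibbsSteadyState → NessUnique → CurrentVarianceLinear → OddDensityIsCorrector →
OddCorrectorDecay → OddResponseBound (measure theory, ~150 Lean lines): μ_{N,T,T} = Gibbs
(uniqueness) is Θ-invariant; h − h∘Θ = (u − u∘Θ)/((N−1)T²); ‖u − u∘Θ‖_{L²(μ_T)} ≤ liminf_τ
‖∫₀^τ(P_tJ − (P_tJ)∘Θ)dt‖ (Fatou) ≤ ∫₀^∞‖P_tJ − (P_tJ)∘Θ‖ dt (Minkowski; joint measurability of the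
kernel is in tree) ≤ C‖J_tot‖_{L²(μ_T)} ≤ C√(cN) (the unnormalised weight cancels); hence N∫(h−hΘ)²
≤ C²cN²/((N−1)²T⁴) ≤ 4C²c/T⁴ for N ≥ 2. [difficulty: M] -/
@[route_item "route-AtomisticToContinuum-StaticIrreversibility"]
def EngineGlue : Prop :=
  GibbsSteadyState → NessUnique → CurrentVarianceLinear → OddDensityIsCorrector → OddCorrectorDecay → OddResponseBound

/-- item stmt-AtomisticToContinuum-6452 · support · rank 9 · closed · moot by None · by planner
sources: Literature.Barriers.AtomisticToContinuum.HasBoundedResponse, BonettoLebowitzReyBellet2000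
[support] GibbsSteadyState → CurrentVarianceLinear → ResponseDensity → OddResponseBound →
BoundedResponse (the ONE-LINE SUFFICIENCY, card item 2; ~250 Lean lines): fix parameters,
uniqueness, a family μ, T > 0 and response coefficients D; μ_{N,T,T} = Gibbs has totalCurrent 0, so
D_N = lim Σ_i (μ_δ(j_i) − μ_T(j_i))/δ = Σ_i ∫ j_i h = ∫ J_tot h (ResponseDensity, uniqueness of
limits along 𝓝[≠]0); Θ-invariance of Gibbs (H∘Θ = H, Lebesgue invariant under (q,p) ↦ (q,−p)) and
J_tot∘Θ = −J_tot give ∫J_tot h = ½∫J_tot(h − h∘Θ) ≤ ½‖J_tot‖·‖h − h∘Θ‖ ≤ ½√(cN·C/N) for N ≥ 2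
(Cauchy–Schwarz, MemLp 2); N ≤ 1: no bonds, D_N = 0; so BddAbove (range |D_N|) along μ, i.e.
HasBoundedResponse by hasBoundedResponse_iff_of_unique (PROVED). [difficulty: M] -/
@[route_item "route-AtomisticToContinuum-StaticIrreversibility"]
def OddSufficiency : Prop :=
  GibbsSteadyState → CurrentVarianceLinear → ResponseDensity → OddResponseBound → BoundedResponse

/-- item stmt-AtomisticToContinuum-6453 · assembly · rank 1 · closed · moot by None · by planner
sources: BonettoLebowitzReyBellet2000, CuneoEckmannHairerReyBellet2018
[assembly] NessUnique → FiniteResponseOfUnique → GibbsSteadyState → CurrentVarianceLinear →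
ResponseDensity → OddResponseBound → BoundedResponseConverges → FouriersLaw (glue: OddSufficiency
gives BoundedResponse; then clause (i) from pinnedChain_exists_isSteadyState + NessUnique, D_N from
FiniteResponseOfUnique, bounded ⇒ convergent-positive by the import slot, κ := the limit). -/
@[route_item "route-AtomisticToContinuum-StaticIrreversibility"]
def Assembly : Prop :=
  NessUnique → FiniteResponseOfUnique → GibbsSteadyState → CurrentVarianceLinear → ResponseDensity → OddResponseBound → BoundedResponseConverges → Literature.MathematicalPhysics.KineticTheory.HeatConduction.FouriersLaw

end Summit.AtomisticToContinuum.FouriersLaw.Theses.StaticIrreversibility
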